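import Mathlib.Algebra.Ring.Int.Units

/-!
# HodgeRepro2 — the root-number parity condition of Rogawski's multiplicity theorem (abstract
interface, proved lemma)

Blind re-derivation cell `pub-hodge-repro2`, seat p2 (file 5; TIER3.md §7 (iii)).

[DR15] = Dimitrov–Ramakrishnan, Doc. Math. 20 (2015), Theorem 3.2 (Rogawski) (iii): "Denote by
`W(λν_M) ∈ {±1}` the root number of Hecke character `λν_M`, where `ν_M(z) = ν(z̄/z)` for
`z ∈ 𝔸_M^×`, and by `s(π)` the number of finite places `v` such that `π_v ≃ π_s(λ_v, ν_v)`. Then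
`π ∈ Π(λ,ν)` is automorphic if and only if `W(λν_M) = (−1)^{d−1+s(π)}`."  The root number and
`s(π)` are taken here as abstract data (`W : ℤˣ`, `d s : ℕ`); the lemma says that a member of
the packet with `s(π) ∈ {0, 1}` always satisfies the condition, which is how [DR15] Prop. 3.6
chooses `π` ("if `W(λ³) = (−1)^d` we choose a prime `𝔮` of `F` which does not split in `M`; if
not, we take `𝔮 = 𝔬`").
-/

namespace Summit.Ventures.HodgeRepro2.ShimuraData

/-- [DR15] Theorem 3.2(iii), abstract interface: `W = (−1)^{d−1+s}` for the root number `W`, the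
degree `d = [F : ℚ]` (written `d = d' + 1` so that no natural-number subtraction occurs) and the
number `s = s(π)` of finite places where `π_v` is the square-integrable member. -/
def RogawskiAutomorphyCondition (W : ℤˣ) (d' s : ℕ) : Prop := W = (-1) ^ (d' + s)

/-- For every root number `W ∈ {±1}` and every degree there is `s ∈ {0, 1}` satisfying the
automorphy condition: `s = 0` if `W = (−1)^{d−1}`, `s = 1` otherwise ([DR15] proof of
Prop. 3.6: the member `π` with `π_𝔮 = π_{s,𝔮}` at one non-split prime `𝔮` when needed). -/
theorem exists_s_le_one (W : ℤˣ) (d' : ℕ) : ∃ s ≤ 1, RogawskiAutomorphyCondition W d' s := by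
  unfold RogawskiAutomorphyCondition
  by_cases h : W = (-1) ^ d'
  · exact ⟨0, Nat.zero_le _, by simpa using h⟩
  · refine ⟨1, le_rfl, ?_⟩
    rcases Int.units_eq_one_or W with hW | hW
    · rcases Int.units_eq_one_or ((-1 : ℤˣ) ^ d') with h1 | h1
      · exact absurd (hW.trans h1.symm) h
      · rw [hW, pow_succ, h1]; rfl
    · rcases Int.units_eq_one_or ((-1 : ℤˣ) ^ d') with h1 | h1
      · rw [hW, pow_succ, h1]; rfl
      · exact absurd (hW.trans h1.symm) h

end Summit.Ventures.HodgeRepro2.ShimuraData
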